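import Literature.NumberTheory.Sieve.ParityWave0SchinzelBatemanHornProofs
import Literature.NumberTheory.Sieve.ParityWave0TwinPrimeProofs
import Literature.NumberTheory.Sieve.BatemanHornMertensProduct
import Literature.NumberTheory.Sieve.HardyLittlewoodProofs
import Summits.Parity.Statement
import HarnessLib

/-!
# The non-linear half of Bateman–Horn already contains Hypothesis H, Dickson and the twin primes

`SoloBlindLinearBH.parity_iff` re-sorts the summit
`Parity = BatemanHorn ∧ GeneralizedHardyLittlewood` as `BH₂ ∧ GHL`, where `BH₂` is the Bateman–Horn conjecture restricted to systems having at least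
one member of degree `≥ 2`, and `GHL` (the generalised Hardy–Littlewood conjecture) carries every
purely linear instance.  One might read this as a split into two *independent* open problems.  It
is not: this file proves that `BH₂` **alone** implies Schinzel's Hypothesis H for *all* systems —
in particular for purely linear ones — hence Dickson's conjecture and the twin prime conjecture.
So the first factor of the summit already decides the *qualitative* content of the second; what
`GHL` adds beyond `BH₂` is only the uniform *asymptotic* for linear systems.

Throughout, **`BH₂`** denotes the statement
`∀ (k : ℕ) (f : Fin k → ℤ[X]), IsBatemanHornSystem f → (∃ i, 2 ≤ (f i).natDegree) →
BatemanHornAsymptotic f`, written out in full in each statement below (no definition and no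
notation is introduced).

## The argument (augmentation by a harmless quadratic)

Let `f₁, …, f_k` be a Bateman–Horn system of linear polynomials.  Put `q = (k+2)!` and
`g = q² X² + q X + 1`.  Then `(g, f₁, …, f_k)` is again a Bateman–Horn system:
* `g` is irreducible in `ℤ[X]` (primitive — its constant coefficient is `1` — and without
  rational roots, since `q²x² + qx + 1 = (qx + ½)² + ¾ > 0`; Gauss's lemma), with leading
  coefficient `q² > 0`, and of degree `2`, so not associated to any (linear) `fᵢ`;
* no fixed prime divisor: for a prime `p ≤ k + 2` we have `p ∣ q`, so `g(n) ≡ 1 (mod p)` for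
  every `n` and `ω_{(g,f)}(p) = ω_f(p) < p`; for a prime `p > k + 2`, `p ∤ q²` and the union
  bound with Lagrange gives `ω_{(g,f)}(p) ≤ 2 + ∑ᵢ deg fᵢ = k + 2 < p`.
`BH₂` applies to the augmented system (it has the member `g` of degree `2`), and a Bateman–Horn
asymptotic with the (PROVED positive, `exists_hasBatemanHornConst_holds`) constant forces
infinitely many `n` at which all members — in particular all `fᵢ` — are simultaneously prime.
Systems that already have a non-linear member need no augmentation.  By the tree's
`schinzelHypothesisH_iff_forall_isBatemanHornSystem` this is exactly Hypothesis H.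

## Main statements

* `schinzelHypothesisH_of_batemanHornNonlinear : BH₂ → SchinzelHypothesisH`
* `dicksonConjecture_of_batemanHornNonlinear`, `twinPrimeConjecture_of_batemanHornNonlinear`,
  `twinPrimeConjecture_of_parity_left` (from `BH₂ ∧ GHL` using the left factor only)
* `isBatemanHornSystem_vecCons_quadratic` (the augmentation lemma) and the per-system lemma
  `setOf_forall_prime_infinite` (a Bateman–Horn asymptotic forces infinitely many simultaneous
  prime values, through the PROVED positivity of the constant).

All elementary; no new analytic input.  (Soloist residency `solo-Parity-blind`, session 13.)
-/

open Filter Finset Polynomial Asymptotics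
open scoped Topology Nat

namespace Summit.Parity.BatemanHorn.Theorems.SoloBlindNonlinearDickson

open Literature.NumberTheory.Sieve

/-! ### A Bateman–Horn asymptotic forces infinitely many simultaneous prime values -/

/-- If a Bateman–Horn system satisfies its Bateman–Horn asymptotic, then `Q(f; x) → ∞`: the
constant of the asymptotic is the ordered Euler-product limit, positive by the PROVED
`exists_hasBatemanHornConst_holds`, and `x / (log x)^k → ∞`. (Per-system version of
`BatemanHornConjecture.tendsto_polyPrimeCount_atTop`.) -/
theorem tendsto_polyPrimeCount_atTop {k : ℕ} {f : Fin k → ℤ[X]} (hf : IsBatemanHornSystem f)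
    (hA : BatemanHornAsymptotic f) :
    Tendsto (fun x : ℕ ↦ (polyPrimeCount f x : ℝ)) atTop atTop := by
  obtain ⟨C, hC, hQ⟩ := hA
  obtain ⟨C', hC'pos, hC'⟩ := exists_hasBatemanHornConst_holds hf
  have hCeq : C = C' := tendsto_nhds_unique hC hC'
  have hprod : 0 < ∏ i, ((f i).natDegree : ℝ) :=
    prod_pos fun i _ ↦ by exact_mod_cast hf.natDegree_pos i
  refine hQ.symm.tendsto_atTop ?_
  have := (tendsto_natCast_div_log_pow_atTop k).const_mul_atTop (div_pos (hCeq ▸ hC'pos) hprod)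
  simpa [mul_div_assoc] using this

/-- If a Bateman–Horn system satisfies its Bateman–Horn asymptotic, then all its members are
simultaneously (positive) primes at infinitely many `n ∈ ℕ`. (Per-system version of
`BatemanHornConjecture.setOf_forall_prime_infinite`.) -/
theorem setOf_forall_prime_infinite {k : ℕ} {f : Fin k → ℤ[X]} (hf : IsBatemanHornSystem f)
    (hA : BatemanHornAsymptotic f) :
    {n : ℕ | ∀ i, 0 < (f i).eval (n : ℤ) ∧ ((f i).eval (n : ℤ)).toNat.Prime}.Infinite := by
  intro hfin
  have hle : ∀ x, (polyPrimeCount f x : ℝ) ≤ hfin.toFinset.card := fun x ↦ by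
    unfold polyPrimeCount
    exact_mod_cast card_le_card fun n hn ↦ hfin.mem_toFinset.2 (mem_filter.1 hn).2
  obtain ⟨x, hx⟩ := ((tendsto_polyPrimeCount_atTop hf hA).eventually
    (eventually_gt_atTop (hfin.toFinset.card : ℝ))).exists
  exact not_lt.2 (hle x) hx

/-! ### The auxiliary quadratic `g_q = q² X² + q X + 1` -/

/-- `g_q(n) = q² n² + q n + 1`. -/
theorem eval_quadratic (q n : ℤ) :
    (C (q ^ 2) * X ^ 2 + C q * X + C 1 : ℤ[X]).eval n = q ^ 2 * n ^ 2 + q * n + 1 := by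
  simp

/-- `deg g_q = 2` for `q ≠ 0`. -/
theorem natDegree_quadratic' {q : ℤ} (hq : q ≠ 0) :
    (C (q ^ 2) * X ^ 2 + C q * X + C 1 : ℤ[X]).natDegree = 2 :=
  natDegree_quadratic (pow_ne_zero 2 hq)

/-- `lc g_q = q²` for `q ≠ 0`. -/
theorem leadingCoeff_quadratic' {q : ℤ} (hq : q ≠ 0) :
    (C (q ^ 2) * X ^ 2 + C q * X + C 1 : ℤ[X]).leadingCoeff = q ^ 2 :=
  leadingCoeff_quadratic (pow_ne_zero 2 hq)

/-- `g_q` is primitive: its constant coefficient is `1`. -/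
theorem isPrimitive_quadratic (q : ℤ) : (C (q ^ 2) * X ^ 2 + C q * X + C 1 : ℤ[X]).IsPrimitive := by
  rw [isPrimitive_iff_isUnit_of_C_dvd]
  intro r hr
  have h0 : r ∣ (C (q ^ 2) * X ^ 2 + C q * X + C 1 : ℤ[X]).coeff 0 :=
    (C_dvd_iff_dvd_coeff r _).1 hr 0
  have hc : (C (q ^ 2) * X ^ 2 + C q * X + C 1 : ℤ[X]).coeff 0 = 1 := by simp
  rw [hc] at h0
  exact isUnit_of_dvd_one h0

/-- `g_q` has no rational root: `q² x² + q x + 1 = (q x + ½)² + ¾ > 0`. -/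
theorem quadratic_map_eval_pos (q : ℤ) (x : ℚ) :
    0 < ((C (q ^ 2) * X ^ 2 + C q * X + C 1 : ℤ[X]).map (Int.castRingHom ℚ)).eval x := by
  have h : ((C (q ^ 2) * X ^ 2 + C q * X + C 1 : ℤ[X]).map (Int.castRingHom ℚ)).eval x =
      ((q : ℚ) * x) ^ 2 + (q : ℚ) * x + 1 := by
    simp; ring
  rw [h]
  nlinarith [sq_nonneg (2 * ((q : ℚ) * x) + 1)]

/-- `g_q` is irreducible in `ℤ[X]` for `q ≠ 0` (Gauss's lemma: primitive, and irreducible over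
`ℚ` as a quadratic without rational roots). -/
theorem irreducible_quadratic {q : ℤ} (hq : q ≠ 0) :
    Irreducible (C (q ^ 2) * X ^ 2 + C q * X + C 1 : ℤ[X]) := by
  rw [IsPrimitive.Int.irreducible_iff_irreducible_map_cast (isPrimitive_quadratic q)]
  have hq' : (q : ℚ) ^ 2 ≠ 0 := pow_ne_zero 2 (by exact_mod_cast hq)
  have hdeg : ((C (q ^ 2) * X ^ 2 + C q * X + C 1 : ℤ[X]).map (Int.castRingHom ℚ)).natDegree
      = 2 := by
    have h : (C (q ^ 2) * X ^ 2 + C q * X + C 1 : ℤ[X]).map (Int.castRingHom ℚ) =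
        C ((q : ℚ) ^ 2) * X ^ 2 + C (q : ℚ) * X + C 1 := by
      simp
    rw [h]
    exact natDegree_quadratic hq'
  refine irreducible_of_degree_le_three_of_not_isRoot (by rw [hdeg]; decide) fun x hx ↦ ?_
  exact (quadratic_map_eval_pos q x).ne' hx

/-- For a prime `p ∣ q`, `g_q(n) ≡ 1 (mod p)`, so `p ∤ g_q(n)`. -/
theorem not_dvd_eval_quadratic {q : ℤ} {p : ℕ} (hp : p.Prime) (hpq : (p : ℤ) ∣ q) (n : ℤ) :
    ¬ (p : ℤ) ∣ (C (q ^ 2) * X ^ 2 + C q * X + C 1 : ℤ[X]).eval n := by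
  intro h
  rw [eval_quadratic] at h
  have h1 : (p : ℤ) ∣ q ^ 2 * n ^ 2 + q * n :=
    dvd_add (dvd_mul_of_dvd_left (dvd_pow hpq two_ne_zero) _) (dvd_mul_of_dvd_left hpq _)
  have h2 : (p : ℤ) ∣ 1 := by simpa using dvd_sub h h1
  exact hp.one_lt.ne' (by exact_mod_cast Int.eq_one_of_dvd_one (by positivity) h2)

/-! ### Root counts: the union bound -/

/-- Union bound for local root counts: `ω_f(p) ≤ ∑ᵢ ρ_{fᵢ}(p)` for a prime `p`. -/
theorem polyRootCountMod_le_sum {ι : Type*} [Fintype ι] (f : ι → ℤ[X]) {p : ℕ}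
    (hp : p.Prime) : polyRootCountMod f p ≤ ∑ i, polyRootCountMod ![f i] p := by
  classical
  simp_rw [polyRootCountMod_single]
  unfold polyRootCountMod
  calc #((range p).filter fun n : ℕ ↦ (p : ℤ) ∣ ∏ i, (f i).eval (n : ℤ))
      ≤ #(univ.biUnion fun i ↦ (range p).filter fun n : ℕ ↦ (p : ℤ) ∣ (f i).eval (n : ℤ)) := by
        refine card_le_card fun n hn ↦ ?_
        rw [mem_filter] at hn
        obtain ⟨i, -, hi⟩ := ((Nat.prime_iff_prime_int.mp hp).dvd_finsetProd_iff _).1 hn.2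
        exact mem_biUnion.2 ⟨i, mem_univ i, mem_filter.2 ⟨hn.1, hi⟩⟩
    _ ≤ ∑ i, #((range p).filter fun n : ℕ ↦ (p : ℤ) ∣ (f i).eval (n : ℤ)) := card_biUnion_le

/-! ### The augmented system -/

/-- **Augmentation.** If `f₁, …, f_k` is a Bateman–Horn system of linear polynomials and `q ≠ 0`
is a multiple of `(k+2)!`, then `(g_q, f₁, …, f_k)` is again a Bateman–Horn system. -/
theorem isBatemanHornSystem_vecCons_quadratic {k : ℕ} {f : Fin k → ℤ[X]}
    (hf : IsBatemanHornSystem f) (hdeg : ∀ i, (f i).natDegree = 1) {q : ℤ} (hq : q ≠ 0)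
    (hfac : ((k + 2)! : ℤ) ∣ q) :
    IsBatemanHornSystem (Matrix.vecCons (C (q ^ 2) * X ^ 2 + C q * X + C 1 : ℤ[X]) f) := by
  refine ⟨?_, ?_, ?_, ?_⟩
  · refine Fin.cases ?_ (fun i ↦ ?_)
    · simpa using irreducible_quadratic hq
    · simpa using hf.irreducible i
  · refine Fin.cases ?_ (fun i ↦ ?_)
    · simp only [Matrix.cons_val_zero, leadingCoeff_quadratic' hq]
      positivity
    · simpa using hf.leadingCoeff_pos i
  · intro i j hij hassoc
    have hdeg2 := natDegree_quadratic' hq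
    rcases Fin.eq_zero_or_eq_succ i with rfl | ⟨i', rfl⟩ <;>
      rcases Fin.eq_zero_or_eq_succ j with rfl | ⟨j', rfl⟩
    · exact hij rfl
    · simp only [Matrix.cons_val_zero, Matrix.cons_val_succ] at hassoc
      have := natDegree_eq_of_degree_eq (degree_eq_degree_of_associated hassoc)
      rw [hdeg2, hdeg j'] at this
      exact absurd this (by decide)
    · simp only [Matrix.cons_val_zero, Matrix.cons_val_succ] at hassoc
      have := natDegree_eq_of_degree_eq (degree_eq_degree_of_associated hassoc)
      rw [hdeg2, hdeg i'] at this
      exact absurd this (by decide)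
    · simp only [Matrix.cons_val_succ] at hassoc
      exact hf.pairwise_not_associated (fun h ↦ hij (by rw [h])) hassoc
  · intro p hp
    have hp' : Prime (p : ℤ) := Nat.prime_iff_prime_int.mp hp
    by_cases hpq : (p : ℤ) ∣ q
    · -- primes dividing `q` (in particular all `p ≤ k + 2`): `g_q ≡ 1 (mod p)`, so
      -- `ω_{(g,f)}(p) = ω_f(p) < p`
      have heq : polyRootCountMod (Matrix.vecCons (C (q ^ 2) * X ^ 2 + C q * X + C 1 : ℤ[X]) f) p
          = polyRootCountMod f p := by
        unfold polyRootCountMod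
        refine congrArg Finset.card (filter_congr fun n _ ↦ ?_)
        rw [Fin.prod_univ_succ]
        simp only [Matrix.cons_val_zero, Matrix.cons_val_succ]
        refine ⟨fun h ↦ ?_, fun h ↦ dvd_mul_of_dvd_right h _⟩
        rcases hp'.dvd_or_dvd h with h1 | h1
        · exact absurd h1 (not_dvd_eval_quadratic hp hpq _)
        · exact h1
      rw [heq]
      exact hf.hasNoFixedPrimeDivisor p hp
    · -- primes not dividing `q`: then `p > k + 2`; union bound and Lagrange, `ω ≤ 2 + k < p`
      have hpk : k + 2 < p := by
        by_contra hle
        exact hpq ((Int.natCast_dvd_natCast.2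
          ((Nat.Prime.dvd_factorial hp).2 (Nat.le_of_not_lt hle))).trans hfac)
      have hlc : ¬ (p : ℤ) ∣ (C (q ^ 2) * X ^ 2 + C q * X + C 1 : ℤ[X]).leadingCoeff := by
        rw [leadingCoeff_quadratic' hq]
        exact fun h ↦ hpq (hp'.dvd_of_dvd_pow h)
      have hg : polyRootCountMod ![(C (q ^ 2) * X ^ 2 + C q * X + C 1 : ℤ[X])] p ≤ 2 :=
        (polyRootCountMod_single_le_natDegree hp hlc).trans (natDegree_quadratic' hq).le
      have hmem : ∀ i, polyRootCountMod ![f i] p ≤ 1 := fun i ↦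
        (BatemanHornMertens.rootCount_single_le_natDegree hf i hp).trans (hdeg i).le
      calc polyRootCountMod (Matrix.vecCons (C (q ^ 2) * X ^ 2 + C q * X + C 1 : ℤ[X]) f) p
          ≤ ∑ i, polyRootCountMod
              ![Matrix.vecCons (C (q ^ 2) * X ^ 2 + C q * X + C 1 : ℤ[X]) f i] p :=
            polyRootCountMod_le_sum _ hp
        _ = polyRootCountMod ![(C (q ^ 2) * X ^ 2 + C q * X + C 1 : ℤ[X])] p
              + ∑ i, polyRootCountMod ![f i] p := by
            rw [Fin.sum_univ_succ]
            simp only [Matrix.cons_val_zero, Matrix.cons_val_succ]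
        _ ≤ 2 + ∑ _i : Fin k, 1 := add_le_add hg (sum_le_sum fun i _ ↦ hmem i)
        _ = k + 2 := by simp [add_comm]
        _ < p := hpk

/-! ### `BH₂` implies Hypothesis H, Dickson, twin primes -/

/-- **`BH₂ ⇒ H`.** The Bateman–Horn conjecture for systems with a non-linear member implies
Schinzel's Hypothesis H for ALL systems (including the purely linear ones, i.e. Dickson's
conjecture): augment a linear system `f₁, …, f_k` by the harmless quadratic `g_{(k+2)!}`. -/
theorem schinzelHypothesisH_of_batemanHornNonlinear
    (h : ∀ (k : ℕ) (f : Fin k → ℤ[X]), IsBatemanHornSystem f → (∃ i, 2 ≤ (f i).natDegree) →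
      BatemanHornAsymptotic f) :
    SchinzelHypothesisH := by
  refine schinzelHypothesisH_iff_forall_isBatemanHornSystem.2 fun k f hf ↦ ?_
  by_cases hex : ∃ i, 2 ≤ (f i).natDegree
  · exact setOf_forall_prime_infinite hf (h k f hf hex)
  · push Not at hex
    have hdeg : ∀ i, (f i).natDegree = 1 := fun i ↦
      le_antisymm (Nat.lt_succ_iff.mp (hex i)) (hf.natDegree_pos i)
    have hq : ((k + 2)! : ℤ) ≠ 0 := by exact_mod_cast Nat.factorial_ne_zero (k + 2)
    have hF := isBatemanHornSystem_vecCons_quadratic hf hdeg hq dvd_rfl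
    have h2 : ∃ i, 2 ≤ (Matrix.vecCons
        (C (((k + 2)! : ℤ) ^ 2) * X ^ 2 + C ((k + 2)! : ℤ) * X + C 1 : ℤ[X]) f i).natDegree :=
      ⟨0, by rw [Matrix.cons_val_zero, natDegree_quadratic' hq]⟩
    refine (setOf_forall_prime_infinite hF (h (k + 1) _ hF h2)).mono fun n hn i ↦ ?_
    simpa using hn i.succ

/-- **`BH₂ ⇒ Dickson`** (hence, by the tree's `DicksonConjecture.weakDicksonHardyLittlewood`,
the prime `k`-tuples conjecture `DHL[k, k]` in existence form for every `k`, Sophie Germain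
primes, de Polignac pairs, …). -/
theorem dicksonConjecture_of_batemanHornNonlinear
    (h : ∀ (k : ℕ) (f : Fin k → ℤ[X]), IsBatemanHornSystem f → (∃ i, 2 ≤ (f i).natDegree) →
      BatemanHornAsymptotic f) :
    DicksonConjecture :=
  dicksonConjecture_of_schinzelHypothesisH (schinzelHypothesisH_of_batemanHornNonlinear h)

/-- **`BH₂ ⇒` twin primes.** -/
theorem twinPrimeConjecture_of_batemanHornNonlinear
    (h : ∀ (k : ℕ) (f : Fin k → ℤ[X]), IsBatemanHornSystem f → (∃ i, 2 ≤ (f i).natDegree) →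
      BatemanHornAsymptotic f) :
    TwinPrimeConjecture :=
  twinPrimeConjecture_of_dicksonConjecture (dicksonConjecture_of_batemanHornNonlinear h)

/-- **The first factor of the re-sorted summit decides the qualitative content of the second**:
from the right-hand side `BH₂ ∧ GHL` of `SoloBlindLinearBH.parity_iff` only the left factor is
used to derive the twin prime conjecture, the qualitative shadow of the `k = 2` case of
`GeneralizedHardyLittlewood`. What `GHL` adds to `BH₂` inside `Parity` is the uniform asymptotic
for linear systems, not the existence of the primes. -/
theorem twinPrimeConjecture_of_parity_left
    (h : (∀ (k : ℕ) (f : Fin k → ℤ[X]), IsBatemanHornSystem f → (∃ i, 2 ≤ (f i).natDegree) →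
      BatemanHornAsymptotic f) ∧ Literature.NumberTheory.Sieve.GeneralizedHardyLittlewood) :
    TwinPrimeConjecture :=
  twinPrimeConjecture_of_batemanHornNonlinear h.1

end Summit.Parity.BatemanHorn.Theorems.SoloBlindNonlinearDickson
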